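import Mathlib
import Summits.ValiantsHypothesis.ValiantsHypothesis.Theorems.FifoMatchingNNDivisionHardFaceBlindFewZones
import HarnessLib

/-!
# ★★★ The FEW-SUMMANDS LAW: a Minkowski passenger `Q = Σ_{i<M} conv(V_i)` of `COR(K_h)` with polynomially many SMALL summands
# (ANY point sets `V_i`) is decided — val-idea-41's few-zones law from SEGMENTS to ARBITRARY summands
# (crux `Theses.FifoMatching.NNDivisionHard`, stmt-ValiantsHypothesis-21181; COR level)

WHAT IS NEW.  The tree's FEW-ZONES LAW (✓ `…FaceBlindFewZones.fewZonesLaw_oneBlock` / `fewZones_decided`) decides ZONOTOPE passengers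
`w + Σ_i [0,1]·gen i` with `M·C(h−t−1,t−1) < C(h−1,t−1)` zones: a one-block map `β` capturing no zone (`exists_oneBlock_avoiding`), a generic
ADMISSIBLE separator (`exists_admissible_sep`), and the one-cut rung `exposedFibreDecided_holds` (val-idea-40).  The ONLY place where
«segments» enter is the exchange argument `maximisers_differ_by_J`.  This file replaces it by the obvious product-family exchange
(`maximiser_coord`: at a maximiser of `c` over `{w + Σ_i v_i : v_i ∈ V_i}` every coordinate maximises `c` over its own summand), so the
SAME machinery decides Minkowski sums of ARBITRARY finite point sets, charging every within-summand DIFFERENCE as a «zone»: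

* `maximiser_coord`, ★ `summandBlind_exposedFibreBlind` — if no within-summand difference `v − v'` (`v, v' ∈ V_i`) outside `ℝJ` is
  symmetric `β`-block-constant, the product family is `ExposedFibreBlind β`;
* ★★★ `summands_three_halves_pow_le` — THE FEW-SUMMANDS LAW: `M` summands of `m` listed points each (repetitions allowed), `2 ≤ m'`,
  `1 ≤ t`, `m'·t ≤ h`, `(M·m²)·C(h−t−1,t−1) < C(h−1,t−1)` ⇒ `(3/2)^{m'−1} ≤ 2(r+1)` for every size-`r` EF of `COR(K_h) + Q`;
* ★★★ `summands_decided` — in the crux's shape at `m' = 2(log₂h+C)^C+4`: `2^((log₂ h + C)^C) < r`.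

Leafhand-8-g1's census asked for exactly this («a chamber pigeonhole charging Minkowski SUMMANDS instead of vertices»); the charge here is
val-idea-41's block-blindness, not the chamber.  The NN-currency reading (products `Π_i p_i` of `M` factors with `Σ|supp p_i|`-type bounds
polynomial in `n`, ANY degrees — containing the zonotope tier ✓ `…ZonotopeProducts` and the products of TRIANGLE-supported factors it left
open) is the sibling `…NNDivisionHardFewSummandsProducts`.

HONEST FRAMING: a certificate for a CLASS of passengers; `CovZonoHard` / COR-MINKOWSKI / COR-VIRTUAL OPEN (survivors: Minkowski sums that need
super-polynomially many summands or summands with super-polynomially many points); stmt-21181 `NNDivisionHard` OPEN; `NNNotVP` OPEN;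
`VP ≠ VNP` NOT proved.  No definitions, no named facts, no sorry.  References: Kaibel–Weltge 2015 [KaibelWeltge2014]; Fiorini et al. 2015
[FioriniEtAl2015].
-/

set_option autoImplicit false

-- the mandated summit-side namespace repeats a component by design (single-problem summit)
set_option linter.dupNamespace false

noncomputable section

open Matrix Finset
open scoped Pointwise

namespace Summit.ValiantsHypothesis.ValiantsHypothesis.Theorems.FifoMatching

namespace Summands

open Literature.Barriers.PneNP (HasEFOfSize)
open Literature.Combinatorics.Optimization (corPolytopeGraph corVec)
open Summit.ValiantsHypothesis.ValiantsHypothesis.Theorems.FifoMatching.ExposedFibre (Jdir)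
open Summit.ValiantsHypothesis.ValiantsHypothesis.Theorems.FifoMatching.FaceBlind
  (BlockConstSymGen ExposedFibreBlind exposedFibreDecided_holds exists_admissible_sep exists_oneBlock_avoiding one_le_L)

variable {h : ℕ}

/-! ## §1 The product-family exchange -/

/-- **EXCHANGE**: at a maximiser `f` of `c` over the product family `{w + Σ_i vtx i (g i)}`, every coordinate `f i` maximises `c` over
its own summand. [folklore] -/
theorem maximiser_coord {M m : ℕ} (c : Fin h × Fin h → ℝ) (vtx : Fin M → Fin m → (Fin h × Fin h → ℝ))
    (w : Fin h × Fin h → ℝ) (f : Fin M → Fin m)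
    (hf : ∀ g : Fin M → Fin m, c ⬝ᵥ (w + ∑ i, vtx i (g i)) ≤ c ⬝ᵥ (w + ∑ i, vtx i (f i))) (i : Fin M) (a : Fin m) :
    c ⬝ᵥ vtx i a ≤ c ⬝ᵥ vtx i (f i) := by
  classical
  have key := hf (Function.update f i a)
  have hdiff : (∑ j, vtx j (Function.update f i a j)) - ∑ j, vtx j (f j) = vtx i a - vtx i (f i) := by
    rw [← Finset.sum_sub_distrib]
    rw [Finset.sum_eq_single i]
    · simp
    · intro j _ hj
      rw [Function.update_of_ne hj, sub_self]
    · intro hi; exact absurd (Finset.mem_univ i) hi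
  have e : c ⬝ᵥ (w + ∑ j, vtx j (Function.update f i a j)) =
      c ⬝ᵥ (w + ∑ j, vtx j (f j)) + (c ⬝ᵥ vtx i a - c ⬝ᵥ vtx i (f i)) := by
    have : w + ∑ j, vtx j (Function.update f i a j) = (w + ∑ j, vtx j (f j)) + (vtx i a - vtx i (f i)) := by
      rw [← hdiff]; abel
    rw [this, dotProduct_add, dotProduct_sub]
  linarith

/-- ★ **SUMMAND-BLIND ⇒ EXPOSED-FIBRE-BLIND**: if every within-summand difference that is symmetric `β`-block-constant lies in `ℝJ`,
then the product family (through any surjective re-indexing `e`) is `ExposedFibreBlind β` — the generic admissible separator of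
✓ `exists_admissible_sep` sees every other within-summand difference, and two maximisers differ by a sum of unseen ones. -/
theorem summandBlind_exposedFibreBlind {M m m' : ℕ} (β : Fin h → Fin m') (vtx : Fin M → Fin m → (Fin h × Fin h → ℝ))
    (w : Fin h × Fin h → ℝ)
    (hbl : ∀ i a b, BlockConstSymGen β (vtx i a - vtx i b) → ∃ α : ℝ, vtx i a - vtx i b = α • Jdir h)
    {J : Type} (e : J → (Fin M → Fin m)) (he : Function.Surjective e) :
    ExposedFibreBlind β (fun j => w + ∑ i, vtx i (e j i)) := by
  classical
  -- the within-summand differences as ONE finite family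
  let eD : Fin M × (Fin m × Fin m) ≃ Fin (M * (m * m)) :=
    (Equiv.prodCongr (Equiv.refl _) finProdFinEquiv).trans finProdFinEquiv
  let gen : Fin (M * (m * m)) → (Fin h × Fin h → ℝ) := fun t =>
    vtx (eD.symm t).1 (eD.symm t).2.1 - vtx (eD.symm t).1 (eD.symm t).2.2
  obtain ⟨c, hc, hsep⟩ := exists_admissible_sep (n := h) (m := m') β gen
  refine ⟨c, hc, fun j j' hj hj' => ?_⟩
  have hjall : ∀ g : Fin M → Fin m, c ⬝ᵥ (w + ∑ i, vtx i (g i)) ≤ c ⬝ᵥ (w + ∑ i, vtx i (e j i)) := by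
    intro g; obtain ⟨k, rfl⟩ := he g; exact hj k
  have hj'all : ∀ g : Fin M → Fin m, c ⬝ᵥ (w + ∑ i, vtx i (g i)) ≤ c ⬝ᵥ (w + ∑ i, vtx i (e j' i)) := by
    intro g; obtain ⟨k, rfl⟩ := he g; exact hj' k
  -- each coordinate difference is unseen by `c`, hence symmetric block-constant, hence in `ℝJ`
  have hcoord : ∀ i, ∃ α : ℝ, vtx i (e j i) - vtx i (e j' i) = α • Jdir h := by
    intro i
    have h1 := maximiser_coord c vtx w (e j) hjall i (e j' i)
    have h2 := maximiser_coord c vtx w (e j') hj'all i (e j i)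
    have hzero : c ⬝ᵥ (vtx i (e j i) - vtx i (e j' i)) = 0 := by rw [dotProduct_sub]; linarith
    by_cases hb : BlockConstSymGen β (vtx i (e j i) - vtx i (e j' i))
    · exact hbl i _ _ hb
    · exfalso
      have hgen : gen (eD (i, (e j i, e j' i))) = vtx i (e j i) - vtx i (e j' i) := by
        simp only [gen, Equiv.symm_apply_apply]
      have := hsep (eD (i, (e j i, e j' i))) (by rw [hgen]; exact hb)
      rw [hgen] at this
      exact this hzero
  choose α hα using hcoord
  refine ⟨∑ i, α i, ?_⟩
  have : (w + ∑ i, vtx i (e j i)) - (w + ∑ i, vtx i (e j' i)) = ∑ i, (vtx i (e j i) - vtx i (e j' i)) := by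
    rw [add_sub_add_left_eq_sub, Finset.sum_sub_distrib]
  rw [this, Finset.sum_smul]
  exact Finset.sum_congr rfl fun i _ => hα i

/-! ## §2 The FEW-SUMMANDS LAW -/

/-- ★★★ **THE FEW-SUMMANDS LAW (PROVED, unconditional):** for a Minkowski passenger `Q = conv{w + Σ_i vtx i (f i) : f}` with `M`
summands of `m ≥ 1` listed points each (repetitions allowed; ANY vectors), `2 ≤ m'`, `1 ≤ t`, `m'·t ≤ h` and
`(M·m²)·C(h−t−1,t−1) < C(h−1,t−1)`: every size-`r` extended formulation of `COR(K_h) + Q` has `(3/2)^{m'−1} ≤ 2(r+1)`.  Segments (`m = 2`):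
the few-zones law. [cite: KaibelWeltge2014, Thm. 1] -/
theorem summands_three_halves_pow_le (h m' t M m : ℕ) (vtx : Fin M → Fin m → (Fin h × Fin h → ℝ))
    (w : Fin h × Fin h → ℝ) (r : ℕ) (hm' : 2 ≤ m') (ht : 1 ≤ t) (hh : m' * t ≤ h) (hm : 1 ≤ m)
    (hcount : (M * (m * m)) * Nat.choose (h - t - 1) (t - 1) < Nat.choose (h - 1) (t - 1))
    (hEF : HasEFOfSize (corPolytopeGraph (⊤ : SimpleGraph (Fin h)) +
      convexHull ℝ (Set.range fun f : Fin M → Fin m => w + ∑ i, vtx i (f i))) r) :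
    (3 / 2 : ℝ) ^ (m' - 1) ≤ 2 * (r + 1) := by
  classical
  let eD : Fin M × (Fin m × Fin m) ≃ Fin (M * (m * m)) :=
    (Equiv.prodCongr (Equiv.refl _) finProdFinEquiv).trans finProdFinEquiv
  let gen : Fin (M * (m * m)) → (Fin h × Fin h → ℝ) := fun s =>
    vtx (eD.symm s).1 (eD.symm s).2.1 - vtx (eD.symm s).1 (eD.symm s).2.2
  obtain ⟨β, ρ, hρ, hZ⟩ := exists_oneBlock_avoiding h m' t (M * (m * m)) hm' ht hh gen hcount
  have hbl : ∀ i a b, BlockConstSymGen β (vtx i a - vtx i b) → ∃ α : ℝ, vtx i a - vtx i b = α • Jdir h := by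
    intro i a b hb
    have hgen : gen (eD (i, (a, b))) = vtx i a - vtx i b := by simp only [gen, Equiv.symm_apply_apply]
    have := hZ (eD (i, (a, b))) (by rw [hgen]; exact hb)
    rwa [hgen] at this
  -- reindex the product family by `Fin (K' + 1)`
  haveI : Nonempty (Fin M → Fin m) := ⟨fun _ => ⟨0, hm⟩⟩
  obtain ⟨K', ⟨e⟩⟩ : ∃ K', Nonempty ((Fin M → Fin m) ≃ Fin (K' + 1)) := by
    refine ⟨Fintype.card (Fin M → Fin m) - 1, ⟨(Fintype.equivFin _).trans (finCongr ?_)⟩⟩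
    have : 0 < Fintype.card (Fin M → Fin m) := Fintype.card_pos
    omega
  have hq : Set.range ((fun f : Fin M → Fin m => w + ∑ i, vtx i (f i)) ∘ e.symm) =
      Set.range (fun f : Fin M → Fin m => w + ∑ i, vtx i (f i)) :=
    Function.Surjective.range_comp e.symm.surjective _
  have hEF' : HasEFOfSize (corPolytopeGraph (⊤ : SimpleGraph (Fin h)) +
      convexHull ℝ (Set.range ((fun f : Fin M → Fin m => w + ∑ i, vtx i (f i)) ∘ e.symm))) r := by
    rw [hq]; exact hEF
  have hE : ExposedFibreBlind β ((fun f : Fin M → Fin m => w + ∑ i, vtx i (f i)) ∘ e.symm) :=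
    summandBlind_exposedFibreBlind β vtx w hbl (fun j => e.symm j) e.symm.surjective
  have hcnt := exposedFibreDecided_holds h m' β ρ hρ K' _ r hE hEF'
  have hR : (3 : ℝ) ^ m' ≤ (r + 1) * 2 ^ (m' + 1) := by exact_mod_cast hcnt
  have h2pos : (0 : ℝ) < 2 ^ m' := by positivity
  have hmain : (3 / 2 : ℝ) ^ m' ≤ 2 * (r + 1) := by
    rw [div_pow, div_le_iff₀ h2pos]
    calc (3 : ℝ) ^ m' ≤ (r + 1) * 2 ^ (m' + 1) := hR
      _ = 2 * (r + 1) * 2 ^ m' := by ring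
  calc (3 / 2 : ℝ) ^ (m' - 1) ≤ (3 / 2) ^ m' := pow_le_pow_right₀ (by norm_num) (Nat.sub_le _ _)
    _ ≤ 2 * (r + 1) := hmain

/-- ★★★ **THE FEW-SUMMANDS LAW IN THE CRUX'S SHAPE:** at level `m' = 2(log₂ h + C)^C + 4`, a Minkowski passenger with `M` summands of
`m ≥ 1` listed points, `(M·m²)·C(h−t−1,t−1) < C(h−1,t−1)` for some `t ≥ 1` with `(2(log₂h+C)^C+4)·t ≤ h`, is DECIDED:
`2^((log₂ h + C)^C) < r` for every extended formulation of `COR(K_h) + Q` of size `r`. [cite: KaibelWeltge2014, Thm. 1] -/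
theorem summands_decided (C h t M m : ℕ) (vtx : Fin M → Fin m → (Fin h × Fin h → ℝ)) (w : Fin h × Fin h → ℝ) (r : ℕ)
    (ht : 1 ≤ t) (hm : 1 ≤ m) (hh : (2 * (Nat.log 2 h + C) ^ C + 4) * t ≤ h)
    (hcount : (M * (m * m)) * Nat.choose (h - t - 1) (t - 1) < Nat.choose (h - 1) (t - 1))
    (hR : HasEFOfSize (corPolytopeGraph (⊤ : SimpleGraph (Fin h)) +
      convexHull ℝ (Set.range fun f : Fin M → Fin m => w + ∑ i, vtx i (f i))) r) :
    2 ^ ((Nat.log 2 h + C) ^ C) < r := by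
  set L := (Nat.log 2 h + C) ^ C with hLdef
  have hdec := summands_three_halves_pow_le h (2 * L + 4) t M m vtx w r (by omega) ht hh hm hcount hR
  have hm1 : 2 * L + 4 - 1 = 2 * L + 3 := by omega
  rw [hm1] at hdec
  have hL : 1 ≤ L := one_le_L h C
  have h1 : (2 : ℝ) ≤ 2 ^ L := by
    calc (2 : ℝ) = 2 ^ 1 := by norm_num
      _ ≤ 2 ^ L := pow_le_pow_right₀ (by norm_num) hL
  have h2 : (2 : ℝ) ^ L ≤ (9 / 4) ^ L := pow_le_pow_left₀ (by norm_num) (by norm_num) L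
  have key : (3 / 2 : ℝ) ^ (2 * L + 3) = (9 / 4) ^ L * (27 / 8) := by
    rw [pow_add, pow_mul]; norm_num
  rw [key] at hdec
  have hlt : (2 : ℝ) ^ L < r := by linarith
  exact_mod_cast hlt

end Summands

end Summit.ValiantsHypothesis.ValiantsHypothesis.Theorems.FifoMatching

end
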